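import Literature.MathematicalPhysics.QuantumManyBody.GroundStateFeynmanKacSemigroup
import Literature.MathematicalPhysics.QuantumManyBody.GroundStateFeynmanKacGaussian
import Literature.MathematicalPhysics.QuantumManyBody.DiluteBoseGasUpperBoundProofs
import Literature.Probability.Process.BrownianVec
import Mathlib.MeasureTheory.Integral.Bochner.ContinuousLinearMap
import Mathlib.MeasureTheory.Integral.MeanInequalities
import Mathlib.MeasureTheory.Integral.Prod
import Mathlib.MeasureTheory.Group.LIntegral
import Mathlib.MeasureTheory.Measure.Haar.OfBasis
import HarnessLib

/-!
# The Dirichlet `N`-body Schrödinger heat flow `e^{-tH_N} ψ₀` through Feynman–Kac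

Topic `Literature/MathematicalPhysics/QuantumManyBody` (definition item `defn-heatFlow`; wanted by
route `BECImaginaryTimeTransport`, cruxes `EnergyVarianceDecay` / `SoftShellRelaxation` /
`HardModeBounds` and support item `TransportBookkeeping`, which currently inline the formula).
Everything is built over the sibling files `GroundStateFeynmanKac.lean` (`PathSpace N`,
`wienerPaths N`, `worldLine`, `pathAction`, `survives`, `expNeg`, `fkWeight`, `fkPathMeasure`,
`fkSemigroup`), `GroundStateFeynmanKacSemigroup.lean` (joint measurability of the weight, the
semigroup law `fkSemigroup_add`), `GroundStateFeynmanKacGaussian.lean` (the Gaussian law of the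
world-lines) and `BoseEinsteinCondensation.lean` (`Config`, `boxN`, `interaction`).

## Content

* `heatFlow v N L t ψ₀ : Config N → ℂ` — **the definition.** For a radial pair potential
  `v : ℝ → [0, ∞]` (`⊤` = hard core allowed), `N` particles in the open box `Λ_L = (0, L)³`
  (Dirichlet), a time `t` and initial data `ψ₀ : (ℝ³)^N → ℂ`:
  `(heatFlow v N L t ψ₀)(X) =`
  `E[ 𝟙{X + √2 b_s ∈ Λ_L^N ∀ s ∈ [0,t]} · e^{-∫₀ᵗ ∑_{i<j} v(|xᵢ-xⱼ|)(X+√2 b_s) ds} · ψ₀(X+√2 b_t) ]`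
  over `3N` independent standard Brownian coordinates `b` (canonical Wiener coordinates of the
  tree), with `e^{-∞} = 0` (an infinite action kills the path). This is the Feynman–Kac (Wiener)
  representation of the Dirichlet Schrödinger semigroup `e^{-tH_N}`,
  `H_N = -∑ᵢ Δᵢ + ∑_{i<j} v(|xᵢ - xⱼ|)` on `L²(Λ_L^N)` (`ħ = 2m = 1`, hence diffusion `√2 b`), taken
  here as the DEFINITION of the flow [ChungZhao1995, §3.3 (34): `E^x{t < τ_D; e_q(t) f(X_t)}` with
  `D = Λ_L^N`, `q = -∑_{i<j} v`]; for quantum gases in a box this Wiener-integral representation of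
  `e^{-βH_N}` is Ginibre's [Ginibre1965] (paywalled here, acquisition requested; cited without
  locator). As a Bochner integral it is `∫ ψ₀(B_t) d(fkPathMeasure v L t X)`
  (`heatFlow_eq_integral_fkPathMeasure`).
* `heatFlowOf W P v L t ψ₀` — the same expectation written over an ARBITRARY `3N`-dimensional
  process `W : ℝ≥0 → Ω → (Fin (N*3) → ℝ)` on `(Ω, P)` (particle `i`, component `k` = coordinate
  `finProdFinEquiv (i, k)`), the shape in which the route's cruxes quantify over Brownian models
  (`Literature.Probability.Process.IsBrownianVec W P`); `configBrownian N` is the canonical model on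
  `PathSpace N` and `heatFlowOf (configBrownian N) (wienerPaths N) = heatFlow`
  (`heatFlowOf_configBrownian`). Model-independence (equality for every `IsBrownianVec` model) is
  NOT asserted here.
* Proved API: unfolding; `t = 0` gives `𝟙_{Λ^N} ψ₀`; the flow vanishes off the open box and only
  sees `ψ₀` on the box; linearity (`smul` always, `add` for bounded data at every time and for `L²`
  data at `t > 0`), complex conjugation, real data stay real (`heatFlow_ofReal`), nonnegative data
  stay nonnegative and are computed by the `[0,∞]`-valued functional `fkSemigroup`
  (`heatFlow_ofReal_eq_fkSemigroup`); the pointwise domination `‖Φ_t(X)‖ₑ ≤ (e^{-tH}‖ψ₀‖)(X)` and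
  the sup bound; measurability of `heatFlow v N L t ψ₀`; insensitivity to null modifications of the
  data for `t > 0` (`heatFlow_congr_ae`); the **`L²`-contraction** `∫ ‖Φ_t‖² ≤ ∫ ‖ψ₀‖²` (Jensen
  under the sub-probability path measure, then drop the weight, Tonelli and translation invariance
  of Lebesgue measure) with its `L¹` companion `∫ (e^{-tH} G) ≤ ∫ G`; **Bose symmetry**:
  relabelling the particles commutes with the flow (`heatFlow_comp_perm`); the **semigroup law**
  `e^{-(s+t)H}ψ₀ = e^{-sH}(e^{-tH}ψ₀)` (`heatFlow_semigroup`, from `fkSemigroup_add`, transferred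
  to complex data by the reduction lemma `eq_of_eq_on_ofReal_nonneg`) for bounded measurable data
  and every measurable `v : ℝ → [0, ∞]`, whence `Z(t) = ‖e^{-tH}ψ₀‖²` is non-increasing; the
  ground-state projection of the flow read off the sibling's `IsGroundStateFK`. (The symmetry
  `⟨φ, e^{-tH}ψ⟩ = ⟨e^{-tH}φ, ψ⟩` for complex data follows the same way from the sibling's
  `lintegral_mul_fkSemigroup_comm` — `GroundStateFeynmanKacSymmetry.lean` — and is left to a
  follow-up file.)
* ONE named fact (bounded measurable `v`, i.e. Chung–Zhao's class `q = -V ∈ L^∞ ⊂ J` on the bounded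
  domain `D = Λ_L^N`): `HeatFlowSpectralMeasure`, the spectral theorem for the self-adjoint
  generator — `⟨ψ₀, e^{-tH}ψ₀⟩ = ∫ e^{-tλ} dμ(λ)` and `‖e^{-tH}ψ₀‖² = ∫ e^{-2tλ} dμ(λ)` for a finite
  positive measure `μ` on `[0, ∞)` of mass `‖𝟙_{Λ^N}ψ₀‖²`.

## Conventions

Time is a real parameter; for `t < 0` the formulas read `t⁺ = 0` in the endpoint and an empty time
interval (so `heatFlow v N L t ψ₀ = ψ₀` for `t < 0`, a harmless junk extension; all statements of
interest carry `0 ≤ t`). The action is `∫⁻ s in Ioc 0 t` (the sibling's `pathAction`); the route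
writes `Icc 0 t`, the same integral (`pathAction_eq_lintegral_Icc`). The route's real weight
`if A = ⊤ then 0 else exp(-A.toReal)` is `(expNeg A).toReal` (`toReal_expNeg`,
`toReal_weightOf_eq`).

## What is NOT here (documented for the requesting route)

Strong continuity / differentiability in `t`, the identification of the generator's quadratic form
with `BoseGas.energy` on `TrialState`s (form core) and `(log Z)'' = 4 Var_t(H)` are not stated:
for bounded `v` they follow from `HeatFlowSpectralMeasure` (Laplace transform calculus) and the
sibling fact `GroundStateFeynmanKac`; for hard cores (`v = ⊤` on a set of radii) the semigroup is
no longer strongly continuous at `t = 0` on all of `L²(Λ^N)` (instant killing on the cores; for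
`v = ⊤` on a closed nowhere dense set of radii of positive measure the accessible region splits into
caged components), and the spectral representation then holds for `t > 0` with a measure of mass
`≤ ‖𝟙_{Λ^N}ψ₀‖²` — to be PROVED from the semigroup law, the symmetry
(`GroundStateFeynmanKacSymmetry.lean`) and the Hilbert–Schmidt bound of the sibling files rather
than vendored; deliberately not stated here.
-/

noncomputable section

open MeasureTheory Filter Metric
open scoped ENNReal NNReal Topology ComplexConjugate

namespace Literature.MathematicalPhysics.QuantumManyBody.BoseGas

open Literature.Probability.Process (preWienerMeasure brownian brownian_zero measurable_brownian
  continuous_brownian)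

variable {N : ℕ}

/-! ### The definition -/

/-- **The Dirichlet `N`-body Schrödinger heat flow through Feynman–Kac.**
`(heatFlow v N L t ψ₀)(X) = E[𝟙{τ_{Λ^N} > t} · exp(-∫₀ᵗ ∑_{i<j} v(|Bⁱ_s - Bʲ_s|) ds) · ψ₀(B_t)]`,
the expectation over the `N` world-lines `Bⁱ_s = Xᵢ + √2 bⁱ_s` (`3N` independent standard Brownian
coordinates, canonical Wiener space of the tree), killed when a world-line leaves the open box
`Λ_L = (0,L)³` during `[0, t]` and weighted by the pair action, with `e^{-∞} = 0` (hard cores kill).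
This is the Wiener-integral representation of `(e^{-tH_N} ψ₀)(X)` for the Dirichlet Hamiltonian
`H_N = -∑Δᵢ + ∑_{i<j} v(|xᵢ-xⱼ|)` on `Λ_L^N` (`ħ = 2m = 1`), taken as the definition of the flow;
as a Bochner integral: `ψ₀(B_t)` against the killed, weighted path measure `fkPathMeasure v L t X`.
For `t < 0` it returns `ψ₀` (junk extension). [cite: ChungZhao1995, §3.3 (34)] -/
def heatFlow (v : ℝ → ℝ≥0∞) (N : ℕ) (L : ℝ) (t : ℝ) (ψ₀ : Config N → ℂ) : Config N → ℂ :=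
  fun X => ∫ ω, (fkWeight v L t X ω).toReal • ψ₀ (worldLine X ω t.toNNReal) ∂wienerPaths N

/-- Unfolding `heatFlow`. [folklore] -/
theorem heatFlow_apply (v : ℝ → ℝ≥0∞) (L t : ℝ) (ψ₀ : Config N → ℂ) (X : Config N) :
    heatFlow v N L t ψ₀ X =
      ∫ ω, (fkWeight v L t X ω).toReal • ψ₀ (worldLine X ω t.toNNReal) ∂wienerPaths N := rfl

/-! ### The same expectation over an arbitrary `3N`-dimensional driving process -/

section Generic

variable {Ω : Type*} [MeasurableSpace Ω]

/-- The `N` world-lines driven by a `3N`-dimensional process `W` (particle `i`, component `k` read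
from coordinate `finProdFinEquiv (i, k)`), started at `X`, at real time `s` (read as `s⁺`):
`Xᵢ + √2 · (W_s)_{(i,·)}`. [folklore] -/
def posOf (W : ℝ≥0 → Ω → (Fin (N * 3) → ℝ)) (X : Config N) (ω : Ω) (s : ℝ) : Config N :=
  fun i => X i + Real.sqrt 2 •
    (WithLp.toLp 2 fun k : Fin 3 => W s.toNNReal ω (finProdFinEquiv (i, k)) : Space)

/-- The Feynman–Kac weight of a sample of the driving process: `𝟙{all world-lines in Λ_L^N on [0,t]}
· exp(-∫₀ᵗ ∑_{i<j} v)`, with `e^{-∞} = 0`. [folklore] -/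
def weightOf (W : ℝ≥0 → Ω → (Fin (N * 3) → ℝ)) (v : ℝ → ℝ≥0∞) (L t : ℝ) (X : Config N) (ω : Ω) :
    ℝ≥0∞ :=
  {ω | ∀ s ∈ Set.Icc (0 : ℝ) t, posOf W X ω s ∈ boxN N L}.indicator
    (fun ω => expNeg (∫⁻ s in Set.Ioc (0 : ℝ) t, interaction v (posOf W X ω s))) ω

/-- The Feynman–Kac expectation `E_P[weight · ψ₀(B_t)]` over an arbitrary driving process `W` on
`(Ω, P)` — the shape in which a statement can quantify over all Brownian models
`IsBrownianVec W P`; for the canonical model it is `heatFlow` (`heatFlowOf_configBrownian`).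
[folklore] -/
def heatFlowOf (W : ℝ≥0 → Ω → (Fin (N * 3) → ℝ)) (P : Measure Ω) (v : ℝ → ℝ≥0∞) (L t : ℝ)
    (ψ₀ : Config N → ℂ) : Config N → ℂ :=
  fun X => ∫ ω, (weightOf W v L t X ω).toReal • ψ₀ (posOf W X ω t) ∂P

/-- On real data the generic expectation is the real `P`-expectation `E_P[weight · f(B_t)]`.
[folklore] -/
theorem heatFlowOf_ofReal (W : ℝ≥0 → Ω → (Fin (N * 3) → ℝ)) (P : Measure Ω) (v : ℝ → ℝ≥0∞)
    (L t : ℝ) (f : Config N → ℝ) (X : Config N) :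
    heatFlowOf W P v L t (fun Y => (f Y : ℂ)) X =
      ((∫ ω, (weightOf W v L t X ω).toReal * f (posOf W X ω t) ∂P : ℝ) : ℂ) := by
  simp only [heatFlowOf, Complex.real_smul, ← Complex.ofReal_mul, integral_complex_ofReal]

end Generic

/-- The canonical `3N`-dimensional Brownian motion on `PathSpace N`, flattened to
`Fin (N * 3) → ℝ`: coordinate `finProdFinEquiv (i, k)` is the Brownian path of `ω i k`.
[folklore] -/
def configBrownian (N : ℕ) (s : ℝ≥0) (ω : PathSpace N) : Fin (N * 3) → ℝ :=
  fun j => brownian s (ω (finProdFinEquiv.symm j).1 (finProdFinEquiv.symm j).2)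

/-- The canonical model's world-lines are the sibling file's `worldLine`. [folklore] -/
theorem posOf_configBrownian (X : Config N) (ω : PathSpace N) (s : ℝ) :
    posOf (configBrownian N) X ω s = worldLine X ω s.toNNReal := by
  funext i
  simp only [posOf, configBrownian, worldLine, Equiv.symm_apply_apply, ← WithLp.toLp_smul]
  rfl

/-- The canonical model's weight is `fkWeight`. [folklore] -/
theorem weightOf_configBrownian (v : ℝ → ℝ≥0∞) (L t : ℝ) (X : Config N) (ω : PathSpace N) :
    weightOf (configBrownian N) v L t X ω = fkWeight v L t X ω := by
  simp only [weightOf, fkWeight, survives, pathAction, posOf_configBrownian]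

/-- **The canonical instance of the generic expectation is `heatFlow`.** [folklore] -/
theorem heatFlowOf_configBrownian (v : ℝ → ℝ≥0∞) (L t : ℝ) (ψ₀ : Config N → ℂ) :
    heatFlowOf (configBrownian N) (wienerPaths N) v L t ψ₀ = heatFlow v N L t ψ₀ := by
  funext X
  simp only [heatFlowOf, heatFlow, weightOf_configBrownian, posOf_configBrownian]

/-! ### Conventions: the action over `[0,t]`, the real weight -/

/-- The action may be integrated over `[0, t]` instead of `(0, t]` (a single time has measure
zero). [folklore] -/
theorem pathAction_eq_lintegral_Icc (v : ℝ → ℝ≥0∞) (T : ℝ) (X : Config N) (ω : PathSpace N) :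
    pathAction v T X ω = ∫⁻ s in Set.Icc (0 : ℝ) T, interaction v (worldLine X ω s.toNNReal) := by
  rw [pathAction, Measure.restrict_congr_set Ioc_ae_eq_Icc]

/-- The real weight `e^{-A}` with `e^{-∞} = 0`, as used inline by the route:
`(expNeg A).toReal = if A = ⊤ then 0 else exp(-A.toReal)`. [folklore] -/
theorem toReal_expNeg (a : ℝ≥0∞) :
    (expNeg a).toReal = if a = ⊤ then 0 else Real.exp (-a.toReal) := by
  unfold expNeg
  split_ifs with h
  · simp
  · exact ENNReal.toReal_ofReal (Real.exp_pos _).le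

/-- The real Feynman–Kac weight is in `[0, 1]`: nonnegativity. [folklore] -/
theorem toReal_fkWeight_nonneg (v : ℝ → ℝ≥0∞) (L T : ℝ) (X : Config N) (ω : PathSpace N) :
    0 ≤ (fkWeight v L T X ω).toReal := ENNReal.toReal_nonneg

/-- The real Feynman–Kac weight is in `[0, 1]`: the upper bound. [folklore] -/
theorem toReal_fkWeight_le_one (v : ℝ → ℝ≥0∞) (L T : ℝ) (X : Config N) (ω : PathSpace N) :
    (fkWeight v L T X ω).toReal ≤ 1 :=
  ENNReal.toReal_le_of_le_ofReal zero_le_one (by simpa using fkWeight_le_one v L T X ω)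

/-- The Feynman–Kac weight is finite. [folklore] -/
theorem fkWeight_ne_top (v : ℝ → ℝ≥0∞) (L T : ℝ) (X : Config N) (ω : PathSpace N) :
    fkWeight v L T X ω ≠ ⊤ :=
  ((fkWeight_le_one v L T X ω).trans_lt ENNReal.one_lt_top).ne

open Classical in
/-- The real weight spelled out as the product of the survival indicator and
`if A = ∞ then 0 else e^{-A}` with the action `A` over `[0, t]` — the integrand the route
`BECImaginaryTimeTransport` writes inline. [folklore] -/
theorem toReal_weightOf_eq {Ω : Type*} [MeasurableSpace Ω] (W : ℝ≥0 → Ω → (Fin (N * 3) → ℝ))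
    (v : ℝ → ℝ≥0∞) (L t : ℝ) (X : Config N) (ω : Ω) :
    (weightOf W v L t X ω).toReal =
      (if ∀ s : ℝ, 0 ≤ s → s ≤ t → posOf W X ω s ∈ boxN N L then (1 : ℝ) else 0) *
        (if (∫⁻ s in Set.Icc 0 t, interaction v (posOf W X ω s)) = ⊤ then (0 : ℝ)
          else Real.exp (-(∫⁻ s in Set.Icc 0 t, interaction v (posOf W X ω s)).toReal)) := by
  have hI : (∫⁻ s in Set.Ioc 0 t, interaction v (posOf W X ω s)) =
      ∫⁻ s in Set.Icc 0 t, interaction v (posOf W X ω s) := by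
    rw [Measure.restrict_congr_set Ioc_ae_eq_Icc]
  have hiff : (∀ s : ℝ, 0 ≤ s → s ≤ t → posOf W X ω s ∈ boxN N L) ↔
      ω ∈ {ω | ∀ s ∈ Set.Icc (0 : ℝ) t, posOf W X ω s ∈ boxN N L} := by
    simp only [Set.mem_setOf_eq, Set.mem_Icc, and_imp]
  unfold weightOf
  by_cases hω : ω ∈ {ω | ∀ s ∈ Set.Icc (0 : ℝ) t, posOf W X ω s ∈ boxN N L}
  · rw [Set.indicator_of_mem hω, if_pos (hiff.2 hω), one_mul, toReal_expNeg, hI]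
  · rw [Set.indicator_of_notMem hω, if_neg (mt hiff.1 hω), zero_mul, ENNReal.toReal_zero]

/-! ### Basic API -/

/-- `heatFlow` as a Bochner integral against the killed, weighted path measure:
`(e^{-tH}ψ₀)(X) = ∫ ψ₀(B_t) d(fkPathMeasure v L t X)` (measurable `v`). [folklore] -/
theorem heatFlow_eq_integral_fkPathMeasure {v : ℝ → ℝ≥0∞} (hv : Measurable v) (L t : ℝ)
    (ψ₀ : Config N → ℂ) (X : Config N) :
    heatFlow v N L t ψ₀ X = ∫ ω, ψ₀ (worldLine X ω t.toNNReal) ∂fkPathMeasure v L t X := by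
  rw [fkPathMeasure, integral_withDensity_eq_integral_toReal_smul (measurable_fkWeight hv L t X)
    (Eventually.of_forall fun ω => (fkWeight_le_one v L t X ω).trans_lt ENNReal.one_lt_top)]
  rfl

/-- Dirichlet killing: `(e^{-tH}ψ₀)(X) = 0` for `X ∉ Λ_L^N` (`t ≥ 0`). [folklore] -/
theorem heatFlow_of_notMem (v : ℝ → ℝ≥0∞) {L t : ℝ} (ht : 0 ≤ t) (ψ₀ : Config N → ℂ)
    {X : Config N} (hX : X ∉ boxN N L) : heatFlow v N L t ψ₀ X = 0 := by
  simp [heatFlow, fkWeight_of_notMem v ht hX]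

/-- For `t ≥ 0` the flow is supported in the open box: `e^{-tH}ψ₀ = 𝟙_{Λ^N} e^{-tH}ψ₀`.
[folklore] -/
theorem indicator_heatFlow (v : ℝ → ℝ≥0∞) (L : ℝ) {t : ℝ} (ht : 0 ≤ t) (ψ₀ : Config N → ℂ) :
    (boxN N L).indicator (heatFlow v N L t ψ₀) = heatFlow v N L t ψ₀ := by
  funext X
  by_cases hX : X ∈ boxN N L
  · exact Set.indicator_of_mem hX _
  · rw [Set.indicator_of_notMem hX, heatFlow_of_notMem v ht ψ₀ hX]

/-- `e^{-0·H} ψ₀ = 𝟙_{Λ^N} ψ₀`. [folklore] -/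
theorem heatFlow_zero (v : ℝ → ℝ≥0∞) (L : ℝ) (ψ₀ : Config N → ℂ) :
    heatFlow v N L 0 ψ₀ = (boxN N L).indicator ψ₀ := by
  funext X
  by_cases hX : X ∈ boxN N L
  · rw [Set.indicator_of_mem hX, heatFlow_apply, fkWeight_zero_of_mem v hX]
    simp
  · rw [Set.indicator_of_notMem hX]
    exact heatFlow_of_notMem v le_rfl ψ₀ hX

/-- The flow only sees the data on the open box: `e^{-tH}(𝟙_{Λ^N}ψ₀) = e^{-tH}ψ₀` (`t ≥ 0`).
[folklore] -/
theorem heatFlow_indicator (v : ℝ → ℝ≥0∞) (L : ℝ) {t : ℝ} (ht : 0 ≤ t) (ψ₀ : Config N → ℂ) :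
    heatFlow v N L t ((boxN N L).indicator ψ₀) = heatFlow v N L t ψ₀ := by
  funext X
  refine integral_congr_ae (Eventually.of_forall fun ω => ?_)
  by_cases hω : ω ∈ survives L t X
  · simp only [Set.indicator_of_mem (hω t ⟨ht, le_rfl⟩)]
  · simp [fkWeight, Set.indicator_of_notMem hω]

/-- For negative times the formula returns the data (empty time interval, `t⁺ = 0`): the junk
extension. [folklore] -/
theorem heatFlow_of_neg (v : ℝ → ℝ≥0∞) (L : ℝ) {t : ℝ} (ht : t < 0) (ψ₀ : Config N → ℂ) :
    heatFlow v N L t ψ₀ = ψ₀ := by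
  funext X
  have hw : ∀ ω, fkWeight v L t X ω = 1 := fun ω => by
    have hs : ω ∈ survives L t X := fun s hs => absurd (hs.1.trans hs.2) (not_le.2 ht)
    simp [fkWeight, Set.indicator_of_mem hs, pathAction, Set.Ioc_eq_empty (not_lt.2 ht.le)]
  have ht0 : t.toNNReal = 0 := Real.toNNReal_of_nonpos ht.le
  simp [heatFlow, hw, ht0]

/-- Homogeneity: `e^{-tH}(c ψ₀) = c · e^{-tH}ψ₀`. [folklore] -/
theorem heatFlow_smul (v : ℝ → ℝ≥0∞) (L t : ℝ) (c : ℂ) (ψ₀ : Config N → ℂ) :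
    heatFlow v N L t (c • ψ₀) = c • heatFlow v N L t ψ₀ := by
  funext X
  simp only [heatFlow_apply, Pi.smul_apply, smul_comm _ c, integral_smul]

/-- `e^{-tH}(-ψ₀) = -e^{-tH}ψ₀`. [folklore] -/
theorem heatFlow_neg (v : ℝ → ℝ≥0∞) (L t : ℝ) (ψ₀ : Config N → ℂ) :
    heatFlow v N L t (-ψ₀) = -heatFlow v N L t ψ₀ := by
  rw [← neg_one_smul ℂ ψ₀, heatFlow_smul, neg_one_smul]

/-- Additivity at a point where both integrands are integrable (always the case for bounded data,
`integrable_fkWeight_smul`; for `L²` data and `t > 0`, `integrable_fkWeight_smul_of_sq`).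
[folklore] -/
theorem heatFlow_add_apply (v : ℝ → ℝ≥0∞) (L t : ℝ) {ψ φ : Config N → ℂ} {X : Config N}
    (hψ : Integrable (fun ω => (fkWeight v L t X ω).toReal • ψ (worldLine X ω t.toNNReal))
      (wienerPaths N))
    (hφ : Integrable (fun ω => (fkWeight v L t X ω).toReal • φ (worldLine X ω t.toNNReal))
      (wienerPaths N)) :
    heatFlow v N L t (ψ + φ) X = heatFlow v N L t ψ X + heatFlow v N L t φ X := by
  simp only [heatFlow_apply, Pi.add_apply, smul_add]
  exact integral_add hψ hφ

/-- Bounded measurable data have integrable Feynman–Kac integrands (for measurable `v`), so that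
`heatFlow_add_apply` applies at every point. [folklore] -/
theorem integrable_fkWeight_smul {v : ℝ → ℝ≥0∞} (hv : Measurable v) (L t : ℝ) {ψ₀ : Config N → ℂ}
    (hψ : Measurable ψ₀) {C : ℝ} (hC : ∀ Y, ‖ψ₀ Y‖ ≤ C) (X : Config N) :
    Integrable (fun ω => (fkWeight v L t X ω).toReal • ψ₀ (worldLine X ω t.toNNReal))
      (wienerPaths N) := by
  refine Integrable.mono' (integrable_const C) ?_ (Eventually.of_forall fun ω => ?_)
  · exact ((measurable_fkWeight hv L t X).ennreal_toReal.smul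
      (hψ.comp (measurable_worldLine X _))).aestronglyMeasurable
  · rw [norm_smul, Real.norm_of_nonneg (toReal_fkWeight_nonneg v L t X ω)]
    exact (mul_le_of_le_one_left (norm_nonneg _) (toReal_fkWeight_le_one v L t X ω)).trans (hC _)

/-- Additivity of the flow on bounded measurable data (as functions; measurable `v`).
[folklore] -/
theorem heatFlow_add_of_bounded {v : ℝ → ℝ≥0∞} (hv : Measurable v) (L t : ℝ)
    {φ₁ φ₂ : Config N → ℂ} (h₁ : Measurable φ₁) (h₂ : Measurable φ₂) {C₁ C₂ : ℝ}
    (hb₁ : ∀ Y, ‖φ₁ Y‖ ≤ C₁) (hb₂ : ∀ Y, ‖φ₂ Y‖ ≤ C₂) :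
    heatFlow v N L t (φ₁ + φ₂) = heatFlow v N L t φ₁ + heatFlow v N L t φ₂ := by
  funext X
  exact heatFlow_add_apply v L t (integrable_fkWeight_smul hv L t h₁ hb₁ X)
    (integrable_fkWeight_smul hv L t h₂ hb₂ X)

/-- Subtractivity of the flow on bounded measurable data (measurable `v`). [folklore] -/
theorem heatFlow_sub_of_bounded {v : ℝ → ℝ≥0∞} (hv : Measurable v) (L t : ℝ)
    {φ₁ φ₂ : Config N → ℂ} (h₁ : Measurable φ₁) (h₂ : Measurable φ₂) {C₁ C₂ : ℝ}
    (hb₁ : ∀ Y, ‖φ₁ Y‖ ≤ C₁) (hb₂ : ∀ Y, ‖φ₂ Y‖ ≤ C₂) :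
    heatFlow v N L t (φ₁ - φ₂) = heatFlow v N L t φ₁ - heatFlow v N L t φ₂ := by
  rw [sub_eq_add_neg, heatFlow_add_of_bounded hv L t h₁ h₂.neg hb₁
    (fun Y => by rw [Pi.neg_apply, norm_neg]; exact hb₂ Y), heatFlow_neg, ← sub_eq_add_neg]

/-- Complex conjugation commutes with the flow (the weights are real). [folklore] -/
theorem heatFlow_conj (v : ℝ → ℝ≥0∞) (L t : ℝ) (ψ₀ : Config N → ℂ) (X : Config N) :
    heatFlow v N L t (fun Y => conj (ψ₀ Y)) X = conj (heatFlow v N L t ψ₀ X) := by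
  simp only [heatFlow_apply, ← integral_conj, Complex.real_smul, map_mul, Complex.conj_ofReal]

/-- **Real data stay real**: on real-valued data the flow is the real Wiener expectation
`E[weight · f(B_t)]`. [folklore] -/
theorem heatFlow_ofReal (v : ℝ → ℝ≥0∞) (L t : ℝ) (f : Config N → ℝ) (X : Config N) :
    heatFlow v N L t (fun Y => (f Y : ℂ)) X =
      ((∫ ω, (fkWeight v L t X ω).toReal * f (worldLine X ω t.toNNReal) ∂wienerPaths N : ℝ) :
        ℂ) := by
  simp only [heatFlow_apply, Complex.real_smul, ← Complex.ofReal_mul, integral_complex_ofReal]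

/-- **Positivity preservation**: nonnegative data stay nonnegative. [folklore] -/
theorem heatFlow_ofReal_nonneg (v : ℝ → ℝ≥0∞) (L t : ℝ) {f : Config N → ℝ} (hf : ∀ Y, 0 ≤ f Y)
    (X : Config N) : 0 ≤ (heatFlow v N L t (fun Y => (f Y : ℂ)) X).re := by
  rw [heatFlow_ofReal, Complex.ofReal_re]
  exact integral_nonneg fun ω => mul_nonneg (toReal_fkWeight_nonneg v L t X ω) (hf _)

/-- **Nonnegative data: the flow is the `[0,∞]`-valued Feynman–Kac functional** `fkSemigroup` of
the sibling file (read back in `ℝ`; both sides are `0` when the functional is infinite).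
[folklore] -/
theorem heatFlow_ofReal_eq_fkSemigroup {v : ℝ → ℝ≥0∞} (hv : Measurable v) (L t : ℝ)
    {f : Config N → ℝ} (hf : Measurable f) (h0 : ∀ Y, 0 ≤ f Y) (X : Config N) :
    heatFlow v N L t (fun Y => (f Y : ℂ)) X =
      ((fkSemigroup v L t (fun Y => ENNReal.ofReal (f Y)) X).toReal : ℂ) := by
  rw [heatFlow_ofReal]
  congr 1
  rw [integral_eq_lintegral_of_nonneg_ae
    (Eventually.of_forall fun ω => mul_nonneg (toReal_fkWeight_nonneg v L t X ω) (h0 _))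
    (((measurable_fkWeight hv L t X).ennreal_toReal.mul
      (hf.comp (measurable_worldLine X _))).aestronglyMeasurable)]
  congr 1
  refine lintegral_congr fun ω => ?_
  rw [ENNReal.ofReal_mul (toReal_fkWeight_nonneg v L t X ω),
    ENNReal.ofReal_toReal (fkWeight_ne_top v L t X ω)]

/-- **Pointwise domination by the flow of the modulus**: `‖(e^{-tH}ψ₀)(X)‖ₑ ≤ (e^{-tH}‖ψ₀‖)(X)`,
the right-hand side being the `[0,∞]`-valued functional. [folklore] -/
theorem enorm_heatFlow_le_fkSemigroup (v : ℝ → ℝ≥0∞) (L t : ℝ) (ψ₀ : Config N → ℂ)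
    (X : Config N) :
    ‖heatFlow v N L t ψ₀ X‖ₑ ≤ fkSemigroup v L t (fun Y => ‖ψ₀ Y‖ₑ) X := by
  refine (enorm_integral_le_lintegral_enorm _).trans (lintegral_mono fun ω => ?_)
  rw [enorm_smul, Real.enorm_eq_ofReal (toReal_fkWeight_nonneg v L t X ω),
    ENNReal.ofReal_toReal (fkWeight_ne_top v L t X ω)]

/-- **Sup bound** (sub-Markov property): `‖(e^{-tH}ψ₀)(X)‖ ≤ sup ‖ψ₀‖`. [folklore] -/
theorem norm_heatFlow_le (v : ℝ → ℝ≥0∞) (L t : ℝ) {ψ₀ : Config N → ℂ} {C : ℝ}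
    (hC : ∀ Y, ‖ψ₀ Y‖ ≤ C) (X : Config N) : ‖heatFlow v N L t ψ₀ X‖ ≤ C := by
  have h := norm_integral_le_of_norm_le_const (μ := wienerPaths N) (C := C)
    (f := fun ω => (fkWeight v L t X ω).toReal • ψ₀ (worldLine X ω t.toNNReal))
    (Eventually.of_forall fun ω => by
      rw [norm_smul, Real.norm_of_nonneg (toReal_fkWeight_nonneg v L t X ω)]
      exact (mul_le_of_le_one_left (norm_nonneg _) (toReal_fkWeight_le_one v L t X ω)).trans
        (hC _))
  simpa [heatFlow_apply] using h

/-! ### Measurability -/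

/-- The complex Feynman–Kac integrand `(X, ω) ↦ weight · ψ₀(B_t)` is jointly measurable, for
measurable `v` and `ψ₀` (joint measurability of the weight: `measurable_fkWeight_uncurry` of the
sibling). [folklore] -/
theorem measurable_fkWeight_smul_uncurry {v : ℝ → ℝ≥0∞} (hv : Measurable v) (L t : ℝ)
    {ψ₀ : Config N → ℂ} (hψ : Measurable ψ₀) :
    Measurable fun p : Config N × PathSpace N =>
      (fkWeight v L t p.1 p.2).toReal • ψ₀ (worldLine p.1 p.2 t.toNNReal) :=
  (measurable_fkWeight_uncurry hv L t).ennreal_toReal.smul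
    (hψ.comp (measurable_worldLine_uncurry' _))

/-- **`heatFlow v N L t ψ₀` is (strongly) measurable** for measurable `v` and `ψ₀`. [folklore] -/
theorem stronglyMeasurable_heatFlow {v : ℝ → ℝ≥0∞} (hv : Measurable v) (L t : ℝ)
    {ψ₀ : Config N → ℂ} (hψ : Measurable ψ₀) : StronglyMeasurable (heatFlow v N L t ψ₀) :=
  (measurable_fkWeight_smul_uncurry hv L t hψ).stronglyMeasurable.integral_prod_right'

/-- `heatFlow v N L t ψ₀` is measurable for measurable `v` and `ψ₀`. [folklore] -/
@[fun_prop]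
theorem measurable_heatFlow {v : ℝ → ℝ≥0∞} (hv : Measurable v) (L t : ℝ) {ψ₀ : Config N → ℂ}
    (hψ : Measurable ψ₀) : Measurable (heatFlow v N L t ψ₀) :=
  (stronglyMeasurable_heatFlow hv L t hψ).measurable

/-! ### Null modifications and `L²` data at positive times -/

/-- **A null modification of the data does not change the flow at any point** (`t > 0`: the law
of `B_t` is absolutely continuous, `comp_worldLine_ae_eq` of the sibling). [folklore] -/
theorem heatFlow_congr_ae (v : ℝ → ℝ≥0∞) (L : ℝ) {t : ℝ} (ht : 0 < t) {ψ ψ' : Config N → ℂ}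
    (h : ψ =ᵐ[volume] ψ') : heatFlow v N L t ψ = heatFlow v N L t ψ' := by
  funext X
  refine integral_congr_ae ?_
  filter_upwards [comp_worldLine_ae_eq X (t := t.toNNReal) (by simpa using ht) h] with ω hω
  rw [hω]

/-- **Square-integrable data have integrable Feynman–Kac integrands at every point for `t > 0`**
(`E[‖ψ₀(B_t)‖] ≤ (4πt)^{-3N/4} ‖ψ₀‖₂`, the free `L² → L^∞` bound `lintegral_worldLine_le_L2` of the
sibling), so that `heatFlow_add_apply` applies at every point. [folklore] -/
theorem integrable_fkWeight_smul_of_sq {v : ℝ → ℝ≥0∞} (hv : Measurable v) (L : ℝ) {t : ℝ}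
    (ht : 0 < t) {ψ₀ : Config N → ℂ} (hψ : Measurable ψ₀) (h2 : ∫⁻ Y, ‖ψ₀ Y‖ₑ ^ 2 ≠ ⊤)
    (X : Config N) :
    Integrable (fun ω => (fkWeight v L t X ω).toReal • ψ₀ (worldLine X ω t.toNNReal))
      (wienerPaths N) := by
  have ht' : t.toNNReal ≠ 0 := by simpa using ht
  refine ⟨((measurable_fkWeight hv L t X).ennreal_toReal.smul
    (hψ.comp (measurable_worldLine X _))).aestronglyMeasurable, ?_⟩
  have h2' : ∫⁻ Y, ‖ψ₀ Y‖ₑ ^ (2 : ℝ) ≠ ⊤ := by simpa only [ENNReal.rpow_two] using h2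
  calc ∫⁻ ω, ‖(fkWeight v L t X ω).toReal • ψ₀ (worldLine X ω t.toNNReal)‖ₑ ∂wienerPaths N
      ≤ ∫⁻ ω, ‖ψ₀ (worldLine X ω t.toNNReal)‖ₑ ∂wienerPaths N := by
        refine lintegral_mono fun ω => ?_
        rw [enorm_smul, Real.enorm_eq_ofReal (toReal_fkWeight_nonneg v L t X ω),
          ENNReal.ofReal_toReal (fkWeight_ne_top v L t X ω)]
        exact (mul_le_mul' (fkWeight_le_one v L t X ω) le_rfl).trans_eq (one_mul _)
    _ < ⊤ := by
        refine (lintegral_worldLine_le_L2 X ht' hψ.enorm).trans_lt (ENNReal.mul_lt_top ?_ ?_)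
        · refine ENNReal.rpow_lt_top_of_nonneg (by norm_num) (ne_of_lt ?_)
          exact ENNReal.prod_lt_top fun i _ => ENNReal.prod_lt_top fun k _ =>
            ENNReal.ofReal_lt_top
        · exact ENNReal.rpow_lt_top_of_nonneg (by norm_num) h2'

/-- **Additivity of the flow on square-integrable measurable data at `t > 0`** (as functions;
measurable `v`). [folklore] -/
theorem heatFlow_add_of_sq {v : ℝ → ℝ≥0∞} (hv : Measurable v) (L : ℝ) {t : ℝ} (ht : 0 < t)
    {φ₁ φ₂ : Config N → ℂ} (h₁ : Measurable φ₁) (h₂ : Measurable φ₂)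
    (hφ₁ : ∫⁻ Y, ‖φ₁ Y‖ₑ ^ 2 ≠ ⊤) (hφ₂ : ∫⁻ Y, ‖φ₂ Y‖ₑ ^ 2 ≠ ⊤) :
    heatFlow v N L t (φ₁ + φ₂) = heatFlow v N L t φ₁ + heatFlow v N L t φ₂ := by
  funext X
  exact heatFlow_add_apply v L t (integrable_fkWeight_smul_of_sq hv L ht h₁ hφ₁ X)
    (integrable_fkWeight_smul_of_sq hv L ht h₂ hφ₂ X)

/-! ### The `L²`-contraction -/

/-- **The adjoint is sub-Markov**: `∫ (e^{-tH} G)(X) dX ≤ ∫ G` for every measurable `G ≥ 0`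
(drop the weight `≤ 1`, Tonelli, translation invariance of Lebesgue measure on `(ℝ³)^N`).
[folklore] -/
theorem lintegral_fkSemigroup_le {v : ℝ → ℝ≥0∞} (L T : ℝ) {G : Config N → ℝ≥0∞}
    (hG : Measurable G) : ∫⁻ X, fkSemigroup v L T G X ≤ ∫⁻ X, G X := by
  calc ∫⁻ X, fkSemigroup v L T G X
      ≤ ∫⁻ X, ∫⁻ ω, G (worldLine X ω T.toNNReal) ∂wienerPaths N :=
        lintegral_mono fun X => fkSemigroup_le_lintegral_worldLine v L T G X
    _ = ∫⁻ ω, ∫⁻ X, G (worldLine X ω T.toNNReal) ∂volume ∂wienerPaths N :=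
        lintegral_lintegral_swap ((hG.comp (measurable_worldLine_uncurry' _)).aemeasurable)
    _ = ∫⁻ ω, ∫⁻ X, G X ∂volume ∂wienerPaths N := by
        refine lintegral_congr fun ω => ?_
        simp only [worldLine_eq_add _ ω]
        exact lintegral_add_right_eq_self G _
    _ = ∫⁻ X, G X := by rw [lintegral_const, measure_univ, mul_one]

/-- **`L¹`-type bound**: `∫ ‖e^{-tH}ψ₀‖ ≤ ∫ ‖ψ₀‖` (measurable `ψ₀`). [folklore] -/
theorem lintegral_enorm_heatFlow_le (v : ℝ → ℝ≥0∞) (L t : ℝ) {ψ₀ : Config N → ℂ}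
    (hψ : Measurable ψ₀) : ∫⁻ X, ‖heatFlow v N L t ψ₀ X‖ₑ ≤ ∫⁻ X, ‖ψ₀ X‖ₑ :=
  (lintegral_mono fun X => enorm_heatFlow_le_fkSemigroup v L t ψ₀ X).trans
    (lintegral_fkSemigroup_le L t hψ.enorm)

/-- **Jensen under the killed path measure**: `‖(e^{-tH}ψ₀)(X)‖ₑ² ≤ (e^{-tH}‖ψ₀‖²)(X)`
(Cauchy–Schwarz against the sub-probability measure `fkPathMeasure`; measurable `v`, `ψ₀`).
[folklore] -/
theorem enorm_heatFlow_sq_le_fkSemigroup {v : ℝ → ℝ≥0∞} (hv : Measurable v) (L t : ℝ)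
    {ψ₀ : Config N → ℂ} (hψ : Measurable ψ₀) (X : Config N) :
    ‖heatFlow v N L t ψ₀ X‖ₑ ^ 2 ≤ fkSemigroup v L t (fun Y => ‖ψ₀ Y‖ₑ ^ 2) X := by
  set μ := fkPathMeasure v L t X with hμ
  set a : PathSpace N → ℝ≥0∞ := fun ω => ‖ψ₀ (worldLine X ω t.toNNReal)‖ₑ with ha
  have ham : AEMeasurable a μ := (hψ.comp (measurable_worldLine X _)).enorm.aemeasurable
  have hμ1 : μ Set.univ ≤ 1 := by
    rw [hμ, fkPathMeasure_univ]; exact fkPartition_le_one v L t X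
  -- `‖Φ‖ₑ ≤ ∫ a dμ ≤ (∫ a² dμ)^{1/2} (μ univ)^{1/2} ≤ (∫ a² dμ)^{1/2}`
  have h1 : ‖heatFlow v N L t ψ₀ X‖ₑ ≤ ∫⁻ ω, a ω ∂μ := by
    rw [heatFlow_eq_integral_fkPathMeasure hv]
    exact enorm_integral_le_lintegral_enorm _
  have h2 : ∫⁻ ω, a ω ∂μ ≤ (∫⁻ ω, a ω ^ 2 ∂μ) ^ (1 / 2 : ℝ) := by
    have hcs := ENNReal.lintegral_mul_le_Lp_mul_Lq μ Real.HolderConjugate.two_two ham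
      aemeasurable_const (g := fun _ => 1)
    simp only [Pi.mul_apply, mul_one, ENNReal.one_rpow, lintegral_const, one_mul] at hcs
    refine hcs.trans ?_
    calc (∫⁻ ω, a ω ^ (2 : ℝ) ∂μ) ^ (1 / (2 : ℝ)) * μ Set.univ ^ (1 / (2 : ℝ))
        ≤ (∫⁻ ω, a ω ^ (2 : ℝ) ∂μ) ^ (1 / (2 : ℝ)) * 1 :=
          mul_le_mul' le_rfl (by simpa using ENNReal.rpow_le_rpow hμ1 (by norm_num : (0:ℝ) ≤ 1/2))
      _ = (∫⁻ ω, a ω ^ 2 ∂μ) ^ (1 / 2 : ℝ) := by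
          rw [mul_one]; simp_rw [ENNReal.rpow_two]
  calc ‖heatFlow v N L t ψ₀ X‖ₑ ^ 2
      ≤ ((∫⁻ ω, a ω ^ 2 ∂μ) ^ (1 / 2 : ℝ)) ^ 2 := pow_le_pow_left' (h1.trans h2) 2
    _ = ∫⁻ ω, a ω ^ 2 ∂μ := by
        rw [← ENNReal.rpow_two, ← ENNReal.rpow_mul]; norm_num
    _ = fkSemigroup v L t (fun Y => ‖ψ₀ Y‖ₑ ^ 2) X := by
        rw [hμ, lintegral_fkPathMeasure hv]; rfl

/-- **`L²`-contraction of the heat flow**: `∫ ‖e^{-tH}ψ₀‖² ≤ ∫ ‖ψ₀‖²` (measurable `v`, `ψ₀`; any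
`t`). [folklore] -/
theorem lintegral_enorm_heatFlow_sq_le {v : ℝ → ℝ≥0∞} (hv : Measurable v) (L t : ℝ)
    {ψ₀ : Config N → ℂ} (hψ : Measurable ψ₀) :
    ∫⁻ X, ‖heatFlow v N L t ψ₀ X‖ₑ ^ 2 ≤ ∫⁻ X, ‖ψ₀ X‖ₑ ^ 2 :=
  (lintegral_mono fun X => enorm_heatFlow_sq_le_fkSemigroup hv L t hψ X).trans
    (lintegral_fkSemigroup_le L t (hψ.enorm.pow_const 2))

/-- The `L²`-contraction in `eLpNorm` form: `‖e^{-tH}ψ₀‖_{L²} ≤ ‖ψ₀‖_{L²}`. [folklore] -/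
theorem eLpNorm_heatFlow_le {v : ℝ → ℝ≥0∞} (hv : Measurable v) (L t : ℝ) {ψ₀ : Config N → ℂ}
    (hψ : Measurable ψ₀) : eLpNorm (heatFlow v N L t ψ₀) 2 volume ≤ eLpNorm ψ₀ 2 volume := by
  rw [eLpNorm_eq_lintegral_rpow_enorm_toReal two_ne_zero ENNReal.ofNat_ne_top,
    eLpNorm_eq_lintegral_rpow_enorm_toReal two_ne_zero ENNReal.ofNat_ne_top]
  simp only [ENNReal.toReal_ofNat, ENNReal.rpow_two]
  exact ENNReal.rpow_le_rpow (lintegral_enorm_heatFlow_sq_le hv L t hψ) (by norm_num)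

/-- `L²` data flow to `L²` functions. [folklore] -/
theorem memLp_heatFlow {v : ℝ → ℝ≥0∞} (hv : Measurable v) (L t : ℝ) {ψ₀ : Config N → ℂ}
    (hψ : Measurable ψ₀) (h2 : MemLp ψ₀ 2 volume) : MemLp (heatFlow v N L t ψ₀) 2 volume :=
  ⟨(stronglyMeasurable_heatFlow hv L t hψ).aestronglyMeasurable,
    (eLpNorm_heatFlow_le hv L t hψ).trans_lt h2.eLpNorm_lt_top⟩

/-! ### Bose symmetry: relabelling the particles commutes with the flow -/

/-- Relabelling the world-lines by a permutation `σ`, as a measurable equivalence of path space.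
[folklore] -/
def permPaths (σ : Equiv.Perm (Fin N)) : PathSpace N ≃ᵐ PathSpace N where
  toFun ω := fun i => ω (σ i)
  invFun ω := fun i => ω (σ.symm i)
  left_inv ω := by funext i; simp
  right_inv ω := by funext i; simp
  measurable_toFun := measurable_pi_lambda _ fun i => measurable_pi_apply _
  measurable_invFun := measurable_pi_lambda _ fun i => measurable_pi_apply _

/-- `permPaths σ ω = ω ∘ σ`. [folklore] -/
@[simp] theorem permPaths_apply (σ : Equiv.Perm (Fin N)) (ω : PathSpace N) (i : Fin N) :
    permPaths σ ω i = ω (σ i) := rfl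

/-- Relabelling independent identically distributed Wiener coordinates preserves their joint law.
[folklore] -/
theorem measurePreserving_permPaths (σ : Equiv.Perm (Fin N)) :
    MeasurePreserving (permPaths σ) (wienerPaths N) (wienerPaths N) := by
  haveI := Literature.Probability.RandomPlanarGeometry.isProbabilityMeasure_preWienerMeasure'
  refine ⟨(permPaths σ).measurable, ?_⟩
  symm
  refine Measure.pi_eq fun s hs => ?_
  rw [Measure.map_apply (permPaths σ).measurable (MeasurableSet.univ_pi hs)]
  have hpre : (permPaths σ) ⁻¹' Set.univ.pi s = Set.univ.pi fun j => s (σ.symm j) := by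
    ext ω
    simp only [Set.mem_preimage, Set.mem_univ_pi, permPaths_apply]
    constructor
    · intro h j; simpa using h (σ.symm j)
    · intro h i; simpa using h (σ i)
  rw [hpre, wienerPaths, Measure.pi_pi]
  exact Fintype.prod_equiv σ.symm _ _ fun _ => rfl

/-- World-lines of relabelled data: `B_s(X ∘ σ, ω ∘ σ) = B_s(X, ω) ∘ σ`. [folklore] -/
theorem worldLine_comp_perm (σ : Equiv.Perm (Fin N)) (X : Config N) (ω : PathSpace N) (s : ℝ≥0) :
    worldLine (X ∘ σ) (permPaths σ ω) s = worldLine X ω s ∘ σ := rfl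

/-- The `N`-particle box is relabelling invariant. [folklore] -/
theorem comp_perm_mem_boxN_iff (σ : Equiv.Perm (Fin N)) (L : ℝ) (Y : Config N) :
    Y ∘ σ ∈ boxN N L ↔ Y ∈ boxN N L := by
  simp only [boxN, Set.mem_setOf_eq, Function.comp_apply]
  exact ⟨fun h i => by simpa using h (σ.symm i), fun h i => h (σ i)⟩

/-- The Feynman–Kac weight is relabelling invariant. [folklore] -/
theorem fkWeight_comp_perm (v : ℝ → ℝ≥0∞) (L T : ℝ) (σ : Equiv.Perm (Fin N)) (X : Config N)
    (ω : PathSpace N) : fkWeight v L T (X ∘ σ) (permPaths σ ω) = fkWeight v L T X ω := by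
  have hsurv : permPaths σ ω ∈ survives L T (X ∘ σ) ↔ ω ∈ survives L T X := by
    simp only [survives, Set.mem_setOf_eq, worldLine_comp_perm, comp_perm_mem_boxN_iff]
  have hact : pathAction v T (X ∘ σ) (permPaths σ ω) = pathAction v T X ω := by
    simp only [pathAction, worldLine_comp_perm]
    refine lintegral_congr fun s => ?_
    exact interaction_comp_equiv v σ _
  unfold fkWeight
  by_cases hω : ω ∈ survives L T X
  · rw [Set.indicator_of_mem (hsurv.2 hω), Set.indicator_of_mem hω, hact]
  · rw [Set.indicator_of_notMem (mt hsurv.1 hω), Set.indicator_of_notMem hω]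

/-- **Relabelling the particles commutes with the flow**:
`(e^{-tH}ψ₀)(X ∘ σ) = (e^{-tH}(ψ₀ ∘ (· ∘ σ)))(X)`. [folklore] -/
theorem heatFlow_comp_perm (v : ℝ → ℝ≥0∞) (L t : ℝ) (ψ₀ : Config N → ℂ) (σ : Equiv.Perm (Fin N))
    (X : Config N) :
    heatFlow v N L t ψ₀ (X ∘ σ) = heatFlow v N L t (fun Y => ψ₀ (Y ∘ σ)) X := by
  rw [heatFlow_apply, heatFlow_apply,
    ← (measurePreserving_permPaths σ).integral_comp' (f := permPaths σ)]
  refine integral_congr_ae (Eventually.of_forall fun ω => ?_)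
  simp only [fkWeight_comp_perm, worldLine_comp_perm]

/-- **Bose symmetry is preserved**: permutation-symmetric data flow to permutation-symmetric
functions. [folklore] -/
theorem heatFlow_perm_of_symm (v : ℝ → ℝ≥0∞) (L t : ℝ) {ψ₀ : Config N → ℂ}
    (hsymm : ∀ (σ : Equiv.Perm (Fin N)) (Y : Config N), ψ₀ (Y ∘ σ) = ψ₀ Y)
    (σ : Equiv.Perm (Fin N)) (X : Config N) :
    heatFlow v N L t ψ₀ (X ∘ σ) = heatFlow v N L t ψ₀ X := by
  rw [heatFlow_comp_perm]
  simp only [hsymm]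

/-! ### Reduction of `ℂ`-linear identities to nonnegative real data -/

/-- **Reduction to nonnegative real data.** Two maps on functions `(ℝ³)^N → ℂ` with values in a
complex vector space, both additive and `ℂ`-homogeneous on bounded measurable functions, that agree
on (the complexification of) bounded nonnegative measurable real functions agree on every bounded
measurable function: decompose into the positive and negative parts of the real and imaginary
parts. The engine that transfers identities of the `[0,∞]`-valued functional `fkSemigroup` to the
complex flow. [folklore] -/
theorem eq_of_eq_on_ofReal_nonneg {E : Type*} [AddCommGroup E] [Module ℂ E]
    {A B : (Config N → ℂ) → E}
    (hA_add : ∀ φ ψ : Config N → ℂ, Measurable φ → Measurable ψ → (∃ C : ℝ, ∀ Y, ‖φ Y‖ ≤ C) →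
      (∃ C : ℝ, ∀ Y, ‖ψ Y‖ ≤ C) → A (φ + ψ) = A φ + A ψ)
    (hA_smul : ∀ (c : ℂ) (φ : Config N → ℂ), Measurable φ → (∃ C : ℝ, ∀ Y, ‖φ Y‖ ≤ C) →
      A (c • φ) = c • A φ)
    (hB_add : ∀ φ ψ : Config N → ℂ, Measurable φ → Measurable ψ → (∃ C : ℝ, ∀ Y, ‖φ Y‖ ≤ C) →
      (∃ C : ℝ, ∀ Y, ‖ψ Y‖ ≤ C) → B (φ + ψ) = B φ + B ψ)
    (hB_smul : ∀ (c : ℂ) (φ : Config N → ℂ), Measurable φ → (∃ C : ℝ, ∀ Y, ‖φ Y‖ ≤ C) →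
      B (c • φ) = c • B φ)
    (h : ∀ f : Config N → ℝ, Measurable f → (∀ Y, 0 ≤ f Y) → (∃ C : ℝ, ∀ Y, f Y ≤ C) →
      A (fun Y => (f Y : ℂ)) = B (fun Y => (f Y : ℂ)))
    {ψ : Config N → ℂ} (hψ : Measurable ψ) (hb : ∃ C : ℝ, ∀ Y, ‖ψ Y‖ ≤ C) : A ψ = B ψ := by
  obtain ⟨C, hC⟩ := hb
  have hC0 : 0 ≤ C := (norm_nonneg _).trans (hC 0)
  -- the four nonnegative pieces, complexified by `F`
  have hre : Measurable fun Y => (ψ Y).re := Complex.measurable_re.comp hψ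
  have him : Measurable fun Y => (ψ Y).im := Complex.measurable_im.comp hψ
  let f₁ : Config N → ℝ := fun Y => max (ψ Y).re 0
  let f₂ : Config N → ℝ := fun Y => max (-(ψ Y).re) 0
  let f₃ : Config N → ℝ := fun Y => max (ψ Y).im 0
  let f₄ : Config N → ℝ := fun Y => max (-(ψ Y).im) 0
  have hm₁ : Measurable f₁ := hre.max measurable_const
  have hm₂ : Measurable f₂ := hre.neg.max measurable_const
  have hm₃ : Measurable f₃ := him.max measurable_const
  have hm₄ : Measurable f₄ := him.neg.max measurable_const
  have h0₁ : ∀ Y, 0 ≤ f₁ Y := fun Y => le_max_right _ _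
  have h0₂ : ∀ Y, 0 ≤ f₂ Y := fun Y => le_max_right _ _
  have h0₃ : ∀ Y, 0 ≤ f₃ Y := fun Y => le_max_right _ _
  have h0₄ : ∀ Y, 0 ≤ f₄ Y := fun Y => le_max_right _ _
  have hb₁ : ∀ Y, f₁ Y ≤ C := fun Y =>
    max_le ((le_abs_self _).trans ((Complex.abs_re_le_norm _).trans (hC Y))) hC0
  have hb₂ : ∀ Y, f₂ Y ≤ C := fun Y =>
    max_le ((neg_le_abs _).trans ((Complex.abs_re_le_norm _).trans (hC Y))) hC0
  have hb₃ : ∀ Y, f₃ Y ≤ C := fun Y =>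
    max_le ((le_abs_self _).trans ((Complex.abs_im_le_norm _).trans (hC Y))) hC0
  have hb₄ : ∀ Y, f₄ Y ≤ C := fun Y =>
    max_le ((neg_le_abs _).trans ((Complex.abs_im_le_norm _).trans (hC Y))) hC0
  let F : (Config N → ℝ) → Config N → ℂ := fun f Y => (f Y : ℂ)
  -- complexified pieces are measurable and bounded; so are multiples and sums
  have cm : ∀ {f : Config N → ℝ}, Measurable f → Measurable (F f) := fun hf =>
    Complex.measurable_ofReal.comp hf
  have cb : ∀ {f : Config N → ℝ}, (∀ Y, 0 ≤ f Y) → (∀ Y, f Y ≤ C) →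
      ∃ C' : ℝ, ∀ Y, ‖F f Y‖ ≤ C' := fun {f} h0 hb =>
    ⟨C, fun Y => by
      change ‖((f Y : ℝ) : ℂ)‖ ≤ C
      rw [Complex.norm_real, Real.norm_of_nonneg (h0 Y)]; exact hb Y⟩
  have sm : ∀ (c : ℂ) {φ : Config N → ℂ}, Measurable φ → Measurable (c • φ) := fun c _ hφ =>
    hφ.const_smul c
  have sb : ∀ (c : ℂ) {φ : Config N → ℂ}, (∃ C' : ℝ, ∀ Y, ‖φ Y‖ ≤ C') →
      ∃ C' : ℝ, ∀ Y, ‖(c • φ) Y‖ ≤ C' := fun c _ ⟨C', hC'⟩ =>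
    ⟨‖c‖ * C', fun Y => by
      rw [Pi.smul_apply, norm_smul]; exact mul_le_mul_of_nonneg_left (hC' Y) (norm_nonneg _)⟩
  have am : ∀ {φ ψ : Config N → ℂ}, Measurable φ → Measurable ψ → Measurable (φ + ψ) :=
    fun h₁ h₂ => h₁.add h₂
  have ab : ∀ {φ ψ : Config N → ℂ}, (∃ C' : ℝ, ∀ Y, ‖φ Y‖ ≤ C') → (∃ C' : ℝ, ∀ Y, ‖ψ Y‖ ≤ C') →
      ∃ C' : ℝ, ∀ Y, ‖(φ + ψ) Y‖ ≤ C' := fun ⟨C₁, h₁⟩ ⟨C₂, h₂⟩ =>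
    ⟨C₁ + C₂, fun Y => (norm_add_le _ _).trans (add_le_add (h₁ Y) (h₂ Y))⟩
  -- the decomposition
  have hdec : ψ = (F f₁ + (-1 : ℂ) • F f₂) + (Complex.I • F f₃ + (-Complex.I) • F f₄) := by
    funext Y
    have e₁ : f₁ Y - f₂ Y = (ψ Y).re := max_zero_sub_max_neg_zero_eq_self _
    have e₂ : f₃ Y - f₄ Y = (ψ Y).im := max_zero_sub_max_neg_zero_eq_self _
    apply Complex.ext
    · simp [F]; linarith
    · simp [F]; linarith
  -- both maps distribute over the decomposition in the same way
  have expand : ∀ (G : (Config N → ℂ) → E),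
      (∀ φ ψ : Config N → ℂ, Measurable φ → Measurable ψ → (∃ C : ℝ, ∀ Y, ‖φ Y‖ ≤ C) →
        (∃ C : ℝ, ∀ Y, ‖ψ Y‖ ≤ C) → G (φ + ψ) = G φ + G ψ) →
      (∀ (c : ℂ) (φ : Config N → ℂ), Measurable φ → (∃ C : ℝ, ∀ Y, ‖φ Y‖ ≤ C) →
        G (c • φ) = c • G φ) →
      G ψ = (G (F f₁) + (-1 : ℂ) • G (F f₂)) +
        (Complex.I • G (F f₃) + (-Complex.I) • G (F f₄)) := by
    intro G hadd hsmul
    rw [hdec, hadd _ _ (am (cm hm₁) (sm _ (cm hm₂))) (am (sm _ (cm hm₃)) (sm _ (cm hm₄)))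
        (ab (cb h0₁ hb₁) (sb _ (cb h0₂ hb₂))) (ab (sb _ (cb h0₃ hb₃)) (sb _ (cb h0₄ hb₄))),
      hadd _ _ (cm hm₁) (sm _ (cm hm₂)) (cb h0₁ hb₁) (sb _ (cb h0₂ hb₂)),
      hadd _ _ (sm _ (cm hm₃)) (sm _ (cm hm₄)) (sb _ (cb h0₃ hb₃)) (sb _ (cb h0₄ hb₄)),
      hsmul _ _ (cm hm₂) (cb h0₂ hb₂), hsmul _ _ (cm hm₃) (cb h0₃ hb₃),
      hsmul _ _ (cm hm₄) (cb h0₄ hb₄)]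
  rw [expand A hA_add hA_smul, expand B hB_add hB_smul, h f₁ hm₁ h0₁ ⟨C, hb₁⟩,
    h f₂ hm₂ h0₂ ⟨C, hb₂⟩, h f₃ hm₃ h0₃ ⟨C, hb₃⟩, h f₄ hm₄ h0₄ ⟨C, hb₄⟩]

/-! ### The semigroup law for the complex flow -/

/-- The semigroup law on bounded NONNEGATIVE real data, read off the `[0,∞]`-valued functional
(`fkSemigroup_add` of the sibling; measurable `v`). [folklore] -/
theorem heatFlow_semigroup_ofReal_nonneg {v : ℝ → ℝ≥0∞} (hv : Measurable v) (L : ℝ) {s t : ℝ}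
    (hs : 0 ≤ s) (ht : 0 ≤ t) {f : Config N → ℝ} (hf : Measurable f) (h0 : ∀ Y, 0 ≤ f Y)
    {C : ℝ} (hfC : ∀ Y, f Y ≤ C) :
    heatFlow v N L (s + t) (fun Y => (f Y : ℂ)) =
      heatFlow v N L s (heatFlow v N L t fun Y => (f Y : ℂ)) := by
  have hgm : Measurable fun Y => ENNReal.ofReal (f Y) := ENNReal.measurable_ofReal.comp hf
  -- the inner flow is the real function `(e^{-tH} g).toReal`, finite since bounded by `C`
  have hin : heatFlow v N L t (fun Y => (f Y : ℂ)) =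
      fun Y => (((fkSemigroup v L t (fun Y => ENNReal.ofReal (f Y)) Y).toReal : ℝ) : ℂ) := by
    funext Y; exact heatFlow_ofReal_eq_fkSemigroup hv L t hf h0 Y
  have hne : ∀ Y, fkSemigroup v L t (fun Y => ENNReal.ofReal (f Y)) Y ≠ ⊤ := fun Y =>
    (((fkSemigroup_le_iSup v L t _ Y).trans
      (iSup_le fun Z => ENNReal.ofReal_le_ofReal (hfC Z))).trans_lt ENNReal.ofReal_lt_top).ne
  rw [hin]
  funext X
  rw [heatFlow_ofReal_eq_fkSemigroup hv L s (measurable_fkSemigroup hv L t hgm).ennreal_toReal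
    (fun Y => ENNReal.toReal_nonneg) X, heatFlow_ofReal_eq_fkSemigroup hv L (s + t) hf h0 X,
    fkSemigroup_add hv L hs ht hgm X]
  congr 3
  funext Y
  exact (ENNReal.ofReal_toReal (hne Y)).symm

/-- **Semigroup law of the heat flow** on bounded measurable data:
`e^{-(s+t)H}ψ₀ = e^{-sH}(e^{-tH}ψ₀)` pointwise, for every measurable `v : ℝ → [0, ∞]` and
`s, t ≥ 0` (the sibling's `fkSemigroup_add`, i.e. the Markov property of the world-lines,
transferred to complex data by `eq_of_eq_on_ofReal_nonneg`). Chung–Zhao (1995), §3.2 (display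
(26) before Thm 3.10) with (3.34). [cite: ChungZhao1995, §3.2 (26) and §3.3 (34)] -/
theorem heatFlow_semigroup {v : ℝ → ℝ≥0∞} (hv : Measurable v) (L : ℝ) {s t : ℝ} (hs : 0 ≤ s)
    (ht : 0 ≤ t) {ψ₀ : Config N → ℂ} (hψ : Measurable ψ₀) (hb : ∃ C : ℝ, ∀ Y, ‖ψ₀ Y‖ ≤ C) :
    heatFlow v N L (s + t) ψ₀ = heatFlow v N L s (heatFlow v N L t ψ₀) := by
  refine eq_of_eq_on_ofReal_nonneg (A := fun ψ => heatFlow v N L (s + t) ψ)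
    (B := fun ψ => heatFlow v N L s (heatFlow v N L t ψ)) ?_ ?_ ?_ ?_ ?_ hψ hb
  · rintro φ ψ hφ hψ ⟨C₁, h₁⟩ ⟨C₂, h₂⟩
    exact heatFlow_add_of_bounded hv L _ hφ hψ h₁ h₂
  · intro c φ _ _
    exact heatFlow_smul v L _ c φ
  · rintro φ ψ hφ hψ ⟨C₁, h₁⟩ ⟨C₂, h₂⟩
    rw [heatFlow_add_of_bounded hv L t hφ hψ h₁ h₂, heatFlow_add_of_bounded hv L s
      (measurable_heatFlow hv L t hφ) (measurable_heatFlow hv L t hψ)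
      (norm_heatFlow_le v L t h₁) (norm_heatFlow_le v L t h₂)]
  · intro c φ _ _
    rw [heatFlow_smul, heatFlow_smul]
  · rintro f hf h0 ⟨C, hC⟩
    exact heatFlow_semigroup_ofReal_nonneg hv L hs ht hf h0 hC

/-- **`t ↦ ‖e^{-tH}ψ₀‖₂²` is non-increasing** on bounded measurable data (semigroup law, then the
`L²`-contraction; measurable `v`). [folklore] -/
theorem lintegral_enorm_heatFlow_sq_add_le {v : ℝ → ℝ≥0∞} (hv : Measurable v) (L : ℝ) {s t : ℝ}
    (hs : 0 ≤ s) (ht : 0 ≤ t) {ψ₀ : Config N → ℂ} (hψ : Measurable ψ₀)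
    (hb : ∃ C : ℝ, ∀ Y, ‖ψ₀ Y‖ ≤ C) :
    ∫⁻ X, ‖heatFlow v N L (s + t) ψ₀ X‖ₑ ^ 2 ≤ ∫⁻ X, ‖heatFlow v N L t ψ₀ X‖ₑ ^ 2 := by
  rw [heatFlow_semigroup hv L hs ht hψ hb]
  exact lintegral_enorm_heatFlow_sq_le hv L s (measurable_heatFlow hv L t hψ)

/-! ### Named fact: the spectral representation (bounded pair potentials) -/

/-- **Spectral representation of the heat flow** (named fact; the spectral theorem for the
Dirichlet Hamiltonian). For a measurable BOUNDED pair potential `v ≥ 0` and measurable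
square-integrable data `ψ₀`, there is a finite positive Borel measure `μ` on `ℝ` carried by
`[0, ∞)`, of total mass `∫_{Λ^N} |ψ₀|²`, with `⟨ψ₀, e^{-tH}ψ₀⟩ = ∫ e^{-tλ} dμ(λ)` and
`‖e^{-tH}ψ₀‖₂² = ∫ e^{-2tλ} dμ(λ)` for all `t ≥ 0` (`μ` = the spectral measure of `𝟙_{Λ^N}ψ₀` for
`H_N`). Assembly of: the Feynman–Kac semigroup (34) on `L²(D)`, `D = Λ_L^N`, `q = -V ∈ L^∞`, is a
strongly continuous symmetric semigroup (Chung–Zhao Thm 3.17 with Thm 3.10), a contraction since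
`q ≤ 0`, whose generator `A₂` is self-adjoint (Chung–Zhao, proof of Prop. 3.29), so that
`T_t = e^{tA₂}` with `-A₂ = H_N ≥ 0`; and the functional calculus `⟨φ, g(A)φ⟩ = ∫ g dμ_φ`,
`‖g(A)φ‖² = ∫ |g|² dμ_φ` (`*`-homomorphism; Reed–Simon I, Thm VIII.5 (a) and (VIII.4)).
[cite: ChungZhao1995, Thm 3.17 and proof of Prop 3.29; ReedSimonI1980, Thm VIII.5] -/
def HeatFlowSpectralMeasure : Prop :=
  ∀ (N : ℕ) (L : ℝ) (v : ℝ → ℝ≥0∞), Measurable v → (∃ C : ℝ≥0, ∀ r, v r ≤ C) →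
    ∀ ψ₀ : Config N → ℂ, Measurable ψ₀ → ∫⁻ X, ‖ψ₀ X‖ₑ ^ 2 ≠ ⊤ →
      ∃ μ : Measure ℝ, IsFiniteMeasure μ ∧ μ (Set.Iio 0) = 0 ∧
        μ Set.univ = ∫⁻ X in boxN N L, ‖ψ₀ X‖ₑ ^ 2 ∧
        (∀ t : ℝ, 0 ≤ t →
          ∫ X, conj (ψ₀ X) * heatFlow v N L t ψ₀ X = ∫ E, (Real.exp (-(t * E)) : ℂ) ∂μ) ∧
        ∀ t : ℝ, 0 ≤ t →
          ∫⁻ X, ‖heatFlow v N L t ψ₀ X‖ₑ ^ 2 = ∫⁻ E, ENNReal.ofReal (Real.exp (-(2 * t * E))) ∂μ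

/-! ### Link with the Feynman–Kac ground state of the sibling file -/

/-- For a Feynman–Kac ground state `Ψ₀` (`IsGroundStateFK v L Ψ₀`) and nonnegative measurable
square-integrable data `f`: **the ground-state projection of the flow**,
`e^{E₀T} (e^{-TH} f)(X) → ⟨Ψ₀, f⟩ Ψ₀(X)` as `T → ∞` for every `X`, `E₀ = groundStateEnergy v N L`
(the sibling's `IsGroundStateFK.tendsto`, read through `heatFlow_ofReal_eq_fkSemigroup`). Under the
sibling's named fact `GroundStateFeynmanKac` (bounded `v`, `N ≥ 1`, `L > 0`) this applies to
`Ψ₀ = fkGroundState v N L`. [folklore] -/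
theorem IsGroundStateFK.tendsto_exp_mul_re_heatFlow {v : ℝ → ℝ≥0∞} (hv : Measurable v) {L : ℝ}
    {Ψ₀ : Config N → ℝ} (h : IsGroundStateFK v L Ψ₀) {f : Config N → ℝ} (hf : Measurable f)
    (h0 : ∀ Y, 0 ≤ f Y) (h2 : ∫⁻ Y, ENNReal.ofReal (f Y) ^ 2 ≠ ⊤) (X : Config N) :
    Tendsto (fun T : ℝ => Real.exp ((groundStateEnergy v N L).toReal * T) *
        (heatFlow v N L T (fun Y => (f Y : ℂ)) X).re) atTop
      (𝓝 ((∫ Y, Ψ₀ Y * f Y) * Ψ₀ X)) := by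
  have hgm : Measurable fun Y => ENNReal.ofReal (f Y) := ENNReal.measurable_ofReal.comp hf
  have hlim := h.tendsto (fun Y => ENNReal.ofReal (f Y)) hgm h2 X
  -- the limit is finite: `⟨Ψ₀, f⟩ ≤ ‖Ψ₀‖₂ ‖f‖₂ < ∞` (Cauchy–Schwarz)
  have hinner : ∫⁻ Y, ENNReal.ofReal (Ψ₀ Y) * ENNReal.ofReal (f Y) ≠ ⊤ := by
    have hcs := ENNReal.lintegral_mul_le_Lp_mul_Lq volume Real.HolderConjugate.two_two
      h.measurable.ennreal_ofReal.aemeasurable hgm.aemeasurable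
    simp only [Pi.mul_apply, ENNReal.rpow_two, h.norm_eq, ENNReal.one_rpow, one_mul] at hcs
    exact ne_top_of_le_ne_top (ENNReal.rpow_ne_top_of_nonneg (by positivity) h2) hcs
  have hlim' := (ENNReal.tendsto_toReal (ENNReal.mul_ne_top hinner ENNReal.ofReal_ne_top)).comp
    hlim
  have hfk : ∀ T : ℝ, (ENNReal.ofReal (Real.exp ((groundStateEnergy v N L).toReal * T)) *
      fkSemigroup v L T (fun Y => ENNReal.ofReal (f Y)) X).toReal =
      Real.exp ((groundStateEnergy v N L).toReal * T) *
        (heatFlow v N L T (fun Y => (f Y : ℂ)) X).re := by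
    intro T
    rw [ENNReal.toReal_mul, ENNReal.toReal_ofReal (Real.exp_pos _).le,
      heatFlow_ofReal_eq_fkSemigroup hv L T hf h0 X, Complex.ofReal_re]
  have hl : ((∫⁻ Y, ENNReal.ofReal (Ψ₀ Y) * ENNReal.ofReal (f Y)) * ENNReal.ofReal (Ψ₀ X)).toReal =
      (∫ Y, Ψ₀ Y * f Y) * Ψ₀ X := by
    rw [ENNReal.toReal_mul, ENNReal.toReal_ofReal (h.nonneg X)]
    congr 1
    rw [integral_eq_lintegral_of_nonneg_ae
      (Eventually.of_forall fun Y => mul_nonneg (h.nonneg Y) (h0 Y))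
      ((h.measurable.mul hf).aestronglyMeasurable)]
    congr 1
    exact lintegral_congr fun Y => by rw [ENNReal.ofReal_mul (h.nonneg Y)]
  simpa only [Function.comp_def, hfk, hl] using hlim'

end Literature.MathematicalPhysics.QuantumManyBody.BoseGas

end
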